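import Mathlib
import Literature.MathematicalPhysics.StatisticalMechanics.Crystallization
import Literature.MathematicalPhysics.StatisticalMechanics.LennardJonesClusters
import Literature.MathematicalPhysics.StatisticalMechanics.StickyChain
import Summits.AtomisticToContinuum.Crystallization.Theses.ThreeConeCertificate
import Summits.AtomisticToContinuum.Crystallization.Theorems.ThreeConeCertificateExactCertificateTransfer1D
import Summits.AtomisticToContinuum.Crystallization.Theorems.ThreeConeCertificateExactCertificateTransfer1DChainEnergy
import Summits.AtomisticToContinuum.Crystallization.Theorems.ThreeConeCertificateExactCertificateTransfer1DLineSort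
import Summits.AtomisticToContinuum.Crystallization.Theorems.ThreeConeCertificateExactCertificateTransfer1DBlockMatching
import Summits.AtomisticToContinuum.Crystallization.Theorems.ThreeConeCertificateExactCertificateTransfer1DLJConvex
import Summits.AtomisticToContinuum.Crystallization.Theorems.ThreeConeCertificateExactCertificateTransfer1DBudget
import Summits.AtomisticToContinuum.Crystallization.Theorems.ThreeConeCertificateExactCertificateTransfer1DMinGap
import Summits.AtomisticToContinuum.Crystallization.Theorems.ThreeConeCertificateExactCertificateTransfer1DMaxGap
import Summits.AtomisticToContinuum.Crystallization.Theorems.ThreeConeCertificateExactCertificateTransfer1DLineConvex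
import Summits.AtomisticToContinuum.Crystallization.Theorems.ThreeConeCertificateExactCertificateTransfer1DPositional
import Summits.AtomisticToContinuum.Crystallization.Theorems.ThreeConeCertificateExactCertificateTransfer1DBulkDefect
import Summits.AtomisticToContinuum.Crystallization.Theorems.ThreeConeCertificateExactCertificateTransfer1DSlackDeleteEnergy
import Summits.AtomisticToContinuum.Crystallization.Theorems.ThreeConeCertificateExactCertificateTransfer1DSlackSiteEnergy
import Summits.AtomisticToContinuum.Crystallization.Theorems.ThreeConeCertificateExactCertificateTransfer1DSlackDeleteCrowded
import Summits.AtomisticToContinuum.Crystallization.Theorems.ThreeConeCertificateExactCertificateTransfer1DSlackContract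
import Summits.AtomisticToContinuum.Crystallization.Theorems.ThreeConeCertificateExactCertificateTransfer1DSlackSqSum
import Summits.AtomisticToContinuum.Crystallization.Theorems.ThreeConeCertificateExactCertificateTransfer1DSlackLocalCount
import Summits.AtomisticToContinuum.Crystallization.Theorems.ThreeConeCertificateExactCertificateTransfer1DSlackBudget
import Summits.AtomisticToContinuum.Crystallization.Theorems.ThreeConeCertificateExactCertificateTransfer1DSlack

/-!
# Crux `ExactCertificate` (stmt-AtomisticToContinuum-11959), line `closure-makes-nogap-exact`, lead c8:
# TRANSFER skeleton IV — slack rigidity of the Lennard-Jones chain (`SlackRigidity1D`)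

Skeleton IV v3 (c8, 2026-08-17) — SORRY-FREE.  v1 registered 06:47Z with 7 stubs, 6 of which LANDED in wave 1 (stub_deleteEnergy p146497,
stub_siteEnergyHalf p146475, stub_deleteCrowded p147930, stub_contract p146527, stub_sqSumOfSlack p146468, stub_localCardBad p149140); v2
(10:05Z) added the budget stub `stub_slackBudget` (LANDED p150903) as a fifth hypothesis of the lead-held assembly `stub_slackAssembly`
(LANDED p151554, file `…Transfer1DSlack.lean`, with the rate form `slackRigidityRate_lennardJones_one` and the route thesis in d = 1
`threeConeThesis_lennardJones_one`).  All eight stubs are imported below; the composition is kernel-closed.  The 3-D line is parked where c5–c7 left it (skeleton v6 of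
`Lines/closure_makes_nogap_exact.lean`: stubs `stub_noGap` = SharpSplit, `stub_periodicMinimum` = KeplerBound =
item 11961 ↔ 0627, both item-level; nothing below is a stub of the 3-D crux).  This file continues the Transfer
lane of c6 (`exactCertificate1D`, `keplerBound1D`, `HasPeriodicGroundStateEnergy lennardJones 1`) and c7
(`Crystallization1D`, `bulkDefectVanish_lennardJones_one`) with the route's THIRD crux: the deciding theorem is

  `SlackRigidity1D` := the route decl `SlackRigidity` (item 11960) with `3 ↦ 1`, verbatim otherwise —

along every sequence of injective configurations of `N` Lennard-Jones particles on a line whose energy excess over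
`E(N)` is `o(N)`, all but `o(N)` particles have their `R`-environment two-way `ε`-matched to `x_i + A(aℤ)` for a
linear isometry `A` (here the identity).  With it the WHOLE route thesis `ExactCertificate ∧ SlackRigidity` and
every hypothesis of `closes` are theorems in d = 1.

## Mechanism (positions sorted, `d_i` = nearest-neighbour gaps, `a` = zero-pressure lattice constant,
## `e_a = Σ_{m≥1} V(ma) ≤ 0`, slack `s = L(y) − N e_a ≥ 0`)

1. CROWDING SURGERY (`stub_deleteEnergy`, `stub_siteEnergyHalf`, `stub_deleteCrowded`): while some gap is `< 3/4`,
   delete the left particle of a closest pair — its site energy is `≥ 1/2` (`δ⁻¹²/12 − (3/8)δ⁻⁶ > 1/2` for `δ < 3/4`),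
   so after `m` deletions `L(y⁽ᵐ⁾) + m/2 ≤ L(y)`; with the Kepler bound at `N − m` and `e_a ≤ 0`, `m ≤ 2s`.  Each
   deletion merges two gaps, so `#bad gaps(y) ≤ #bad gaps(y⁽ᵐ⁾) + 2m` for every gap predicate.
2. STRETCH SURGERY (`stub_contract`): replace every gap `> 1` by exactly `1`; pair distances weakly decrease but stay
   `≥ 1` where they change and `V` increases on `[1,∞)`, so the energy weakly decreases and the result lies in the box.
3. CONVEXITY WITH SLACK (`stub_sqSumOfSlack` = c7's `stub_lineEnergyConvex` with the Kepler bound for the midpoint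
   configuration in place of minimality): `Σ_i (a − gap_i)² ≤ 2(s + C_a)` on the box.
4. COUNT: contracted gaps have `gap = 1` and `|a − 1| = 1 − a > 0` (a < 1 STRICTLY: ζ(12) < ζ(6)), so Chebyshev bounds
   both the contracted and the `η`-bad gaps: `#η-bad gaps(y) ≤ 4s + 2(s + C_a)(4/(1−a)² + 1/η²)`.
5. LOCAL MATCHING (`stub_localCardBad`): a rank at index distance `≥ K` from both ends all of whose `2K` surrounding
   gaps are `η`-good (`η ≤ 1/4`, so good gaps are `≥ 1/2`) is a good particle (`K = ⌈2R⌉ + 1`, `η = min(ε/K, 1/4)`);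
   bad particles `≤ 2K + 2K·#η-bad gaps = o(N)` since `s_N ≤ (E(x_N) − E(N)) + C_a = o(N)` (chain trial state).
-/

noncomputable section

namespace Summit.AtomisticToContinuum.Crystallization.Cruxes.ExactCertificate.Transfer1D

open Literature.MathematicalPhysics.StatisticalMechanics MeasureTheory Set Filter Topology
open scoped BigOperators
open Summit.AtomisticToContinuum.Crystallization.Theorems.ThreeConeCertificateExactCertificate.Transfer1D

/-- The d = 1 analogue of the route decl `ThreeConeCertificate.SlackRigidity` (item stmt-AtomisticToContinuum-11960):
the statement with `3 ↦ 1`, verbatim otherwise. -/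
def SlackRigidity1D : Prop :=
  ∃ P : PeriodicConfiguration 1, ∀ R ε : ℝ, 0 < R → 0 < ε →
    ∀ x : (N : ℕ) → (Fin N → EuclideanSpace ℝ (Fin 1)), (∀ N, Function.Injective (x N)) →
      Tendsto (fun N : ℕ => (interactionEnergy lennardJones (x N) - groundStateEnergy lennardJones 1 N) / N)
        atTop (𝓝 0) →
      Tendsto (fun N : ℕ => (Nat.card {i : Fin N // ¬ ∃ A : EuclideanSpace ℝ (Fin 1) →ₗᵢ[ℝ] EuclideanSpace ℝ (Fin 1),
          (∀ p ∈ P.points, ‖p‖ ≤ R → ∃ j : Fin N, dist (x N j) (x N i + A p) ≤ ε) ∧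
          (∀ j : Fin N, dist (x N j) (x N i) ≤ R → ∃ p ∈ P.points, dist (x N j) (x N i + A p) ≤ ε)} : ℝ) / N)
        atTop (𝓝 0)

/-! ## The stubs — ALL LANDED (imported; namespace `…Theorems.ThreeConeCertificateExactCertificate.Transfer1D`)

Wave 1: `stub_deleteEnergy` (A1, deletion identity, p146497), `stub_siteEnergyHalf` (A2, quantitative crowding, p146475),
`stub_deleteCrowded` (B, crowding surgery, p147930), `stub_contract` (C, stretch surgery, p146527), `stub_sqSumOfSlack` (D, convexity
with slack, p146468), `stub_localCardBad` (E, local matching count, p149140); lead: `stub_slackBudget` (G, `a < 1`, `e_a ≤ 0`, p150903),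
`stub_slackAssembly` (F, the assembly, p151554). -/

open Summit.AtomisticToContinuum.Crystallization.Theorems.ThreeConeCertificateExactCertificate.Transfer1D
  (stub_deleteEnergy stub_siteEnergyHalf stub_deleteCrowded stub_contract stub_sqSumOfSlack stub_localCardBad
   stub_slackBudget stub_slackAssembly slackRigidity_lennardJones_one slackRigidityRate_lennardJones_one
   threeConeThesis_lennardJones_one)

/-! ## Composition: the stubs close `SlackRigidity1D` -/

/-- **SLACK RIGIDITY OF THE LENNARD-JONES CHAIN** (`SlackRigidity` with `3 ↦ 1`): composition of the registered stubs. -/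
theorem SlackRigidity1D_of : SlackRigidity1D := by
  unfold SlackRigidity1D
  exact stub_slackAssembly (stub_deleteCrowded stub_deleteEnergy stub_siteEnergyHalf) stub_contract stub_sqSumOfSlack
    stub_localCardBad stub_slackBudget

/-- **SLACK RIGIDITY OF THE LENNARD-JONES CHAIN** (`SlackRigidity` with `3 ↦ 1`). -/
theorem slackRigidity1D : SlackRigidity1D := SlackRigidity1D_of

end Summit.AtomisticToContinuum.Crystallization.Cruxes.ExactCertificate.Transfer1D

end
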